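import Mathlib
import Summits.ValiantsHypothesis.ValiantsHypothesis.Theses.ValuativeGCT
import Summits.ValiantsHypothesis.ValiantsHypothesis.Theorems.ValuativeGCTValuativeBound
import Summits.ValiantsHypothesis.ValiantsHypothesis.Theorems.ValuativeGCTGctMultPrinciple
import Summits.ValiantsHypothesis.ValiantsHypothesis.Theorems.ValuativeGCTNoValuativeFlipSharpResidual
import Summits.ValiantsHypothesis.ValiantsHypothesis.Theorems.ValuativeGCTNoValuativeFlipUnconditional

/-!
# `TailFlip` — negative lemmas III: the kill statement transfers; flips are border obstructions

Crux `stmt-ValiantsHypothesis-15687` (`Theses.ValuativeGCT.TailFlip`, route ValuativeGCT, rev 4).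
Logical position of the crux, sorry-free (standing disprover, cdisprove cycle 1, 2026-08-16,
`Cruxes/TailFlip/Disproof.lean` §4–§5):

* `not_tailFlip_of_noValuativeFlip` — the route's kill statement `NoValuativeFlip` (stmt-12629)
  REFUTES the crux (padding `n^(c₀+2)` lies in the tail of window `c₀ + 3`); contrapositive
  `not_noValuativeFlip_of_tailFlip`; hence `dcPerSuperpolynomial_of_tailFlip` — proving the crux proves
  Valiant's hypothesis in determinantal-complexity form (`dcPerSuperpolynomial_of_not_noValuativeFlip'`),
  so refuting it inside the window is the OPEN valuative multiplicity no-go and proving it is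
  Valiant-hard.
* `not_valuativeFlip_of_not_tailFlip` — a kill here kills the parent crux `ValuativeFlip` (#2).
* `tailFlip_border` — throughout the tail a flip excludes a border determinantal expression of the
  padded permanent (`ValuativeBound_proof` + multiplicity-obstruction principle `GctMultPrinciple_proof`).
* `tail_witness_constraints`, `tail_witness_occurs` — what a witness `(U, r, δ, λ)` at a tail position
  must look like: `m + 1 < 2ⁿ`, Kadish–Landsberg shape, length beyond the inheritance range
  (`valuativeFlip_witness_constraints`), and for `m ≥ n^25` occurrence on BOTH sides,
  `0 < K_m(λ*) ≤ dim T_U(λ)` (BIP 2019 Thm 1.4 via `valuativeFlip_witness_occurs`).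

Sources: BLMW 2011 (arXiv:0907.2850) §5; Bürgisser–Ikenmeyer–Panova 2019 (arXiv:1604.06431) Thm 1.4;
Kadish–Landsberg 2014 (arXiv:1204.4693) Thm 1.2; Bläser–Ikenmeyer 2025 (doi:10.4086/toc.gs.2025.010)
§12.4; Landsberg 2017 Conj. 1.2.4.2. [folklore]
-/

-- `Summit.ValiantsHypothesis.ValiantsHypothesis.…` repeats a component by the D-0017 layout
-- (single-conjunct summit), which the `dupNamespace` linter flags; the name is mandated.
set_option linter.dupNamespace false

namespace Summit.ValiantsHypothesis.ValiantsHypothesis.Theorems.TailFlip.Negative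

open Literature.NumberTheory.DiophantineGeometry Literature.Computability.AlgebraicComplexity
open Summit.ValiantsHypothesis.ValiantsHypothesis.Theses.ValuativeGCT
open Summit.ValiantsHypothesis.ValiantsHypothesis.Theorems.NoValuativeFlip
open Summit.ValiantsHypothesis.ValiantsHypothesis.Theorems.ValuativeBound

/-- `b < a` and `a·n < b·m` force `n < m`. [folklore] -/
theorem lt_of_slope {a b n m : ℕ} (hba : b < a) (h : a * n < b * m) : n < m := by
  by_contra hge
  rw [not_lt] at hge
  have h1 : b * m ≤ b * n := Nat.mul_le_mul_left b hge
  have h2 : b * n ≤ a * n := Nat.mul_le_mul_right n hba.le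
  omega

/-- **A kill here kills the parent**: `¬ TailFlip → ¬ ValuativeFlip` (the crux is the parent's
restriction to the tail; then `closes` has a refuted binder — route kill criterion "TailFlip refuted
⇒ handle as refuted:ValuativeFlip"). -/
theorem not_valuativeFlip_of_not_tailFlip (h : ¬ TailFlip) : ¬ ValuativeFlip := by
  intro hV
  refine h fun a b hba c => ?_
  obtain ⟨n₀, hn₀⟩ := hV c
  exact ⟨n₀, fun n hn m _ hlt hm => hn₀ n hn m (lt_of_slope hba hlt).le hm⟩

/-- **Kill statement transfers to the child**: `NoValuativeFlip → ¬ TailFlip`.  Given the exponent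
`c₀` and threshold `n₀` of the no-go, run the crux at slope `2/1` with window constant `c₀ + 3`; at
`n = max (max n₀ n₁) 3` the padding `m = n^(c₀+2)` lies in the tail (`2n < n² ≤ m`,
`pow_succ_le_two_pow_log_add_pow`) and is `≥ n^c₀`, so the flip contradicts the no-go.  Refuting the
crux is therefore implied by — and inside the window amounts to — the OPEN valuative multiplicity
no-go (stmt-12629; Bläser–Ikenmeyer 2025 §12.4). -/
theorem not_tailFlip_of_noValuativeFlip (hno : NoValuativeFlip) : ¬ TailFlip := by
  intro h
  obtain ⟨c₀, n₀, hS⟩ := hno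
  obtain ⟨n₁, hn₁⟩ := h 2 1 one_lt_two (c₀ + 3)
  set n : ℕ := max (max n₀ n₁) 3 with hn
  have hn0 : n₀ ≤ n := (le_max_left _ _).trans (le_max_left _ _)
  have hn1 : n₁ ≤ n := (le_max_right _ _).trans (le_max_left _ _)
  have hn3 : 3 ≤ n := le_max_right _ _
  haveI : NeZero (n ^ (c₀ + 2)) := ⟨pow_ne_zero _ (by omega)⟩
  have hwin : n ^ (c₀ + 2) ≤ 2 ^ ((Nat.log 2 n + (c₀ + 3)) ^ (c₀ + 3)) :=
    pow_succ_le_two_pow_log_add_pow n (c₀ + 1)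
  have hsq : n * n ≤ n ^ (c₀ + 2) := by
    rw [← pow_two]
    exact Nat.pow_le_pow_right (by omega) (by omega)
  have htail : 2 * n < 1 * n ^ (c₀ + 2) := by nlinarith
  have hpad : n ^ c₀ ≤ n ^ (c₀ + 2) := Nat.pow_le_pow_right (by omega) (by omega)
  obtain ⟨U, r, δ, lam, hU, hcard, hlt⟩ := hn₁ n hn1 (n ^ (c₀ + 2)) htail hwin
  exact (not_le.mpr hlt) (hS n hn0 (n ^ (c₀ + 2)) hpad U r hU δ lam hcard)

/-- Contrapositive: **`TailFlip → ¬ NoValuativeFlip`** (proving the crux refutes the route's kill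
statement stmt-12629). -/
theorem not_noValuativeFlip_of_tailFlip (h : TailFlip) : ¬ NoValuativeFlip :=
  fun hno => not_tailFlip_of_noValuativeFlip hno h

/-- **`TailFlip → DcPerSuperpolynomial ℂ`**: proving the crux proves Valiant's hypothesis in
determinantal-complexity form (Landsberg 2017 Conj. 1.2.4.2), via
`dcPerSuperpolynomial_of_not_noValuativeFlip'`. -/
theorem dcPerSuperpolynomial_of_tailFlip (h : TailFlip) : DcPerSuperpolynomial ℂ :=
  dcPerSuperpolynomial_of_not_noValuativeFlip' (not_noValuativeFlip_of_tailFlip h)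

/-- **`TailFlip` in border-complexity currency**: eventually in `n`, NO position of the tail window
carries a border determinantal expression of the padded permanent — each flip `dim T_U(λ) < mult_pp`
gives `K_m(λ*) < mult_pp(λ*)` (`ValuativeBound_proof`) and the multiplicity-obstruction principle
(`GctMultPrinciple_proof`, stmt-0889) excludes `X₀₀^(m-n) per_n` from `Δ(det_m)`. -/
theorem tailFlip_border (h : TailFlip) :
    ∀ a b : ℕ, b < a → ∀ c : ℕ, ∃ n₀ : ℕ, ∀ n ≥ n₀, ∀ (m : ℕ) [NeZero m],
      a * n < b * m → m ≤ 2 ^ ((Nat.log 2 n + c) ^ c) → ¬ HasBorderDetRepr ℂ n m := by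
  intro a b hba c
  obtain ⟨n₀, hn₀⟩ := h a b hba c
  refine ⟨n₀, fun n hn m _ hlt hm => ?_⟩
  obtain ⟨U, r, δ, lam, hU, hcard, hflip⟩ := hn₀ n hn m hlt hm
  exact Summit.ValiantsHypothesis.ValiantsHypothesis.Theorems.GctMultPrinciple_proof n m _
    (lt_of_slope hba hlt).le (lt_of_le_of_lt (ValuativeBound_proof m U r hU δ lam hcard) hflip)

/-- **Shape constraints on a tail witness** (landed no-flip ranges, contrapositive;
`valuativeFlip_witness_constraints` with `ValuativeBound_proof`): at a tail position (`b < a`,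
`a·n < b·m`) a witness `(U, r, δ, λ)` has `m + 1 < 2ⁿ`, `δ(m-n) ≤ λ₁`, `ℓ(λ) ≤ n² + 1` and
`m < 1 + n(n+1)^ℓ(λ)` — Kadish–Landsberg shapes whose length grows like `log m / log n`. -/
theorem tail_witness_constraints {a b n : ℕ} (m : ℕ) [NeZero m] (hba : b < a) (htail : a * n < b * m)
    (U : Submodule ℂ (MatIdx m → ℂ)) (r : ℕ)
    (hU : ∀ u ∈ U, (Matrix.of fun a b : Fin m => u (toLex (a, b))).rank ≤ r)
    (δ : ℕ) (lam : Nat.Partition (m * δ)) (hcard : lam.parts.card ≤ m * m)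
    (hflip : (let χ : Literature.NumberTheory.DiophantineGeometry.Weight (Literature.NumberTheory.DiophantineGeometry.MatIdx m) := (Literature.NumberTheory.DiophantineGeometry.Weight.dualOfPartition (m * m) lam).toMatIdx; let T : Submodule ℂ (MvPolynomial (Literature.NumberTheory.DiophantineGeometry.MatIdx m × Literature.NumberTheory.DiophantineGeometry.MatIdx m) ℂ) := MvPolynomial.homogeneousSubmodule (Literature.NumberTheory.DiophantineGeometry.MatIdx m × Literature.NumberTheory.DiophantineGeometry.MatIdx m) ℂ (m * δ) ⊓ ((MvPolynomial.vanishingIdeal ℂ {p : Literature.NumberTheory.DiophantineGeometry.MatIdx m × Literature.NumberTheory.DiophantineGeometry.MatIdx m → ℂ | ∀ j : Literature.NumberTheory.DiophantineGeometry.MatIdx m, (fun i => p (j, i)) ∈ U}) ^ (δ * (m - r))).restrictScalars ℂ ⊓ (⨅ (M : Matrix (Literature.NumberTheory.DiophantineGeometry.MatIdx m) (Literature.NumberTheory.DiophantineGeometry.MatIdx m) ℂ) (_ : Literature.Computability.AlgebraicComplexity.linSubst (Literature.NumberTheory.DiophantineGeometry.MatIdx m) ℂ M (Literature.NumberTheory.DiophantineGeometry.detFormLex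 ℂ m) = Literature.NumberTheory.DiophantineGeometry.detFormLex ℂ m), LinearMap.ker ((MvPolynomial.aeval (R := ℂ) fun p : Literature.NumberTheory.DiophantineGeometry.MatIdx m × Literature.NumberTheory.DiophantineGeometry.MatIdx m => ∑ l : Literature.NumberTheory.DiophantineGeometry.MatIdx m, M l p.2 • MvPolynomial.X (p.1, l)).toLinearMap - LinearMap.id (R := ℂ) (M := MvPolynomial (Literature.NumberTheory.DiophantineGeometry.MatIdx m × Literature.NumberTheory.DiophantineGeometry.MatIdx m) ℂ))) ⊓ (⨅ (g : Matrix.GeneralLinearGroup (Literature.NumberTheory.DiophantineGeometry.MatIdx m) ℂ) (_ : Literature.NumberTheory.DiophantineGeometry.IsUpperTriangular g), LinearMap.ker ((MvPolynomial.aeval (R := ℂ) fun p : Literature.NumberTheory.DiophantineGeometry.MatIdx m × Literature.NumberTheory.DiophantineGeometry.MatIdx m => ∑ l : Literature.NumberTheory.DiophantineGeometry.MatIdx m, ((g⁻¹ : Matrix.GeneralLinearGroup (Literature.NumberTheory.DiophantineGeometry.MatIdx m) ℂ) : Matrix (Literature.NumberTheory.DiophantineGeometry.MatIdx m) (Literature.NumberTheory.DiophantineGeometry.MatIdx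 m) ℂ) p.1 l • MvPolynomial.X (l, p.2)).toLinearMap - Literature.NumberTheory.DiophantineGeometry.weightChar χ g • LinearMap.id (R := ℂ) (M := MvPolynomial (Literature.NumberTheory.DiophantineGeometry.MatIdx m × Literature.NumberTheory.DiophantineGeometry.MatIdx m) ℂ))); Module.finrank ℂ ↥T < Literature.NumberTheory.DiophantineGeometry.orbitMultiplicity ℂ (Literature.NumberTheory.DiophantineGeometry.paddedPerFormLex ℂ n m) m χ)) :
    m + 1 < 2 ^ n ∧ δ * (m - n) ≤ lam.parts.sup ∧ lam.parts.card ≤ n ^ 2 + 1 ∧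
      m < 1 + n * (n + 1) ^ lam.parts.card :=
  valuativeFlip_witness_constraints ValuativeBound_proof m (lt_of_slope hba htail).le U r hU δ lam
    hcard hflip

/-- **In the polynomial part of the tail a witness occurs on both sides** (`0 < n`, `n^25 ≤ m`;
Bürgisser–Ikenmeyer–Panova 2019 Thm 1.4 via `valuativeFlip_witness_occurs`): `0 < K_m(λ*)` and
`0 < dim T_U(λ)` — the flip is a genuine multiplicity obstruction against a nonzero truncation. -/
theorem tail_witness_occurs {n : ℕ} (m : ℕ) [NeZero m] (hn : 0 < n) (hnm : n ^ 25 ≤ m)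
    (U : Submodule ℂ (MatIdx m → ℂ)) (r : ℕ)
    (hU : ∀ u ∈ U, (Matrix.of fun a b : Fin m => u (toLex (a, b))).rank ≤ r)
    (δ : ℕ) (lam : Nat.Partition (m * δ)) (hcard : lam.parts.card ≤ m * m)
    (hflip : (let χ : Literature.NumberTheory.DiophantineGeometry.Weight (Literature.NumberTheory.DiophantineGeometry.MatIdx m) := (Literature.NumberTheory.DiophantineGeometry.Weight.dualOfPartition (m * m) lam).toMatIdx; let T : Submodule ℂ (MvPolynomial (Literature.NumberTheory.DiophantineGeometry.MatIdx m × Literature.NumberTheory.DiophantineGeometry.MatIdx m) ℂ) := MvPolynomial.homogeneousSubmodule (Literature.NumberTheory.DiophantineGeometry.MatIdx m × Literature.NumberTheory.DiophantineGeometry.MatIdx m) ℂ (m * δ) ⊓ ((MvPolynomial.vanishingIdeal ℂ {p : Literature.NumberTheory.DiophantineGeometry.MatIdx m × Literature.NumberTheory.DiophantineGeometry.MatIdx m → ℂ | ∀ j : Literature.NumberTheory.DiophantineGeometry.MatIdx m, (fun i => p (j, i)) ∈ U}) ^ (δ * (m - r))).restrictScalars ℂ ⊓ (⨅ (M : Matrix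 (Literature.NumberTheory.DiophantineGeometry.MatIdx m) (Literature.NumberTheory.DiophantineGeometry.MatIdx m) ℂ) (_ : Literature.Computability.AlgebraicComplexity.linSubst (Literature.NumberTheory.DiophantineGeometry.MatIdx m) ℂ M (Literature.NumberTheory.DiophantineGeometry.detFormLex ℂ m) = Literature.NumberTheory.DiophantineGeometry.detFormLex ℂ m), LinearMap.ker ((MvPolynomial.aeval (R := ℂ) fun p : Literature.NumberTheory.DiophantineGeometry.MatIdx m × Literature.NumberTheory.DiophantineGeometry.MatIdx m => ∑ l : Literature.NumberTheory.DiophantineGeometry.MatIdx m, M l p.2 • MvPolynomial.X (p.1, l)).toLinearMap - LinearMap.id (R := ℂ) (M := MvPolynomial (Literature.NumberTheory.DiophantineGeometry.MatIdx m × Literature.NumberTheory.DiophantineGeometry.MatIdx m) ℂ))) ⊓ (⨅ (g : Matrix.GeneralLinearGroup (Literature.NumberTheory.DiophantineGeometry.MatIdx m) ℂ) (_ : Literature.NumberTheory.DiophantineGeometry.IsUpperTriangular g), LinearMap.ker ((MvPolynomial.aeval (R := ℂ) fun p : Literature.NumberTheory.DiophantineGeometry.MatIdx m × Literature.NumberTheory.DiophantineGeometry.MatIdx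 m => ∑ l : Literature.NumberTheory.DiophantineGeometry.MatIdx m, ((g⁻¹ : Matrix.GeneralLinearGroup (Literature.NumberTheory.DiophantineGeometry.MatIdx m) ℂ) : Matrix (Literature.NumberTheory.DiophantineGeometry.MatIdx m) (Literature.NumberTheory.DiophantineGeometry.MatIdx m) ℂ) p.1 l • MvPolynomial.X (l, p.2)).toLinearMap - Literature.NumberTheory.DiophantineGeometry.weightChar χ g • LinearMap.id (R := ℂ) (M := MvPolynomial (Literature.NumberTheory.DiophantineGeometry.MatIdx m × Literature.NumberTheory.DiophantineGeometry.MatIdx m) ℂ))); Module.finrank ℂ ↥T < Literature.NumberTheory.DiophantineGeometry.orbitMultiplicity ℂ (Literature.NumberTheory.DiophantineGeometry.paddedPerFormLex ℂ n m) m χ)) :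
    let χ : Literature.NumberTheory.DiophantineGeometry.Weight (Literature.NumberTheory.DiophantineGeometry.MatIdx m) := (Literature.NumberTheory.DiophantineGeometry.Weight.dualOfPartition (m * m) lam).toMatIdx; let T : Submodule ℂ (MvPolynomial (Literature.NumberTheory.DiophantineGeometry.MatIdx m × Literature.NumberTheory.DiophantineGeometry.MatIdx m) ℂ) := MvPolynomial.homogeneousSubmodule (Literature.NumberTheory.DiophantineGeometry.MatIdx m × Literature.NumberTheory.DiophantineGeometry.MatIdx m) ℂ (m * δ) ⊓ ((MvPolynomial.vanishingIdeal ℂ {p : Literature.NumberTheory.DiophantineGeometry.MatIdx m × Literature.NumberTheory.DiophantineGeometry.MatIdx m → ℂ | ∀ j : Literature.NumberTheory.DiophantineGeometry.MatIdx m, (fun i => p (j, i)) ∈ U}) ^ (δ * (m - r))).restrictScalars ℂ ⊓ (⨅ (M : Matrix (Literature.NumberTheory.DiophantineGeometry.MatIdx m) (Literature.NumberTheory.DiophantineGeometry.MatIdx m) ℂ) (_ : Literature.Computability.AlgebraicComplexity.linSubst (Literature.NumberTheory.DiophantineGeometry.MatIdx m) ℂ M (Literature.NumberTheory.DiophantineGeometry.detFormLex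 ℂ m) = Literature.NumberTheory.DiophantineGeometry.detFormLex ℂ m), LinearMap.ker ((MvPolynomial.aeval (R := ℂ) fun p : Literature.NumberTheory.DiophantineGeometry.MatIdx m × Literature.NumberTheory.DiophantineGeometry.MatIdx m => ∑ l : Literature.NumberTheory.DiophantineGeometry.MatIdx m, M l p.2 • MvPolynomial.X (p.1, l)).toLinearMap - LinearMap.id (R := ℂ) (M := MvPolynomial (Literature.NumberTheory.DiophantineGeometry.MatIdx m × Literature.NumberTheory.DiophantineGeometry.MatIdx m) ℂ))) ⊓ (⨅ (g : Matrix.GeneralLinearGroup (Literature.NumberTheory.DiophantineGeometry.MatIdx m) ℂ) (_ : Literature.NumberTheory.DiophantineGeometry.IsUpperTriangular g), LinearMap.ker ((MvPolynomial.aeval (R := ℂ) fun p : Literature.NumberTheory.DiophantineGeometry.MatIdx m × Literature.NumberTheory.DiophantineGeometry.MatIdx m => ∑ l : Literature.NumberTheory.DiophantineGeometry.MatIdx m, ((g⁻¹ : Matrix.GeneralLinearGroup (Literature.NumberTheory.DiophantineGeometry.MatIdx m) ℂ) : Matrix (Literature.NumberTheory.DiophantineGeometry.MatIdx m) (Literature.NumberTheory.DiophantineGeometry.MatIdx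 m) ℂ) p.1 l • MvPolynomial.X (l, p.2)).toLinearMap - Literature.NumberTheory.DiophantineGeometry.weightChar χ g • LinearMap.id (R := ℂ) (M := MvPolynomial (Literature.NumberTheory.DiophantineGeometry.MatIdx m × Literature.NumberTheory.DiophantineGeometry.MatIdx m) ℂ))); 0 < Literature.NumberTheory.DiophantineGeometry.orbitMultiplicity ℂ (Literature.NumberTheory.DiophantineGeometry.detFormLex ℂ m) m χ ∧ 0 < Module.finrank ℂ ↥T :=
  valuativeFlip_witness_occurs m hn hnm U r hU δ lam hcard hflip

end Summit.ValiantsHypothesis.ValiantsHypothesis.Theorems.TailFlip.Negative
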